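import Mathlib
import Summits.ResolutionOfSingularities.ResolutionOfSingularities.Theorems.WeightedInvariantLocalWeightedDropPolyDescentBridge
import Summits.ResolutionOfSingularities.ResolutionOfSingularities.Theorems.WeightedInvariantLocalWeightedDropPolyDescentPrepExists
import Summits.ResolutionOfSingularities.ResolutionOfSingularities.Theorems.WeightedInvariantLocalWeightedDropPolyDescentNoChain
import Summits.ResolutionOfSingularities.ResolutionOfSingularities.Theorems.WeightedInvariantLocalWeightedDropPolyDescentMinimality

/-!
# `WeightedInvariant.LocalWeightedDrop`, TOT2-LINE piece S-E2′: THE REGIME «e = 2» OF THE POLYHEDRON GAME — its labels, its descent relation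
# (well-founded by ρ-T), the POLYHEDRON RANK, and how labels leave the regime

Crux item stmt-ResolutionOfSingularities-8899 `LocalWeightedDrop` (route `ResolutionOfSingularities/WeightedInvariant`), ENGINE skeleton v32
(ddb48572591139d5), registered stub `stub_spaceNCRankDrop`; TOT2-LINE v1.2 §(E) piece S-E2′ (`L/res-L1-w43-lead-1/g4/TOT2-LINE.md`).
[OURS · L1 W4.3 · chain w43 · lead-1 gen 4; bricks: lead-1's ρ-T `PolyDescent.stub_polyNoChain` (p517324) with ρ-P `stub_polyPrep` (res-type-061 +
stub-2, p519588) and `stub_polyMinimality`, the well-preparedness transports `wellPrepared_divOneT/divTwoT/blowOneT/blowTwoT`.  MODEL: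
Cossart–Jannsen–Saito LNM 2270 Thm 5.40 / §§10–13 read WITHOUT the isolation hypothesis.  Nothing here is a statement of any manuscript;
AI-produced, gate-checked, weaker than expert review.  Packaging-independent: usable by the `Represents` bridge (…NCPolyBridgeExit) and by the
decorated assembly on res-L1-w43-stub-1's S-SET / res-L1-w43-stub-2's …TOT2Bridge* alike.]

* `PolyDescent.InPoly d A` — the regime: well-prepared, positive (`IsPosT`), non-empty Newton set;
* `PolyDescent.PolyRel d A′ A` — `A′ ∈ succT d A`, both in the regime;  `wellFounded_polyRel` — ρ-T as well-foundedness;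
* `PolyDescent.polyRank hd A : Ordinal` — the rank in the descent relation;  `polyRank_lt` — a regime step lowers it;
* `wellPrepared_of_mem_succT` — successors of well-prepared positive labels are well-prepared;  `exit_cases` — a successor outside the regime has
  empty Newton set or is not positive (order drop / directrix growth).
-/

set_option linter.dupNamespace false -- mandated namespace of this single-conjunct summit

noncomputable section

namespace Summit.ResolutionOfSingularities.ResolutionOfSingularities.Theorems

namespace PolyDescent

open MvPowerSeries MonicDescent WildMonic

variable {k : Type} [Field k]

/-! ## The regime and its descent relation -/

/-- THE LABELS OF THE REGIME «e = 2»: well-prepared positive labels with non-empty Newton set (the hypotheses of ρ-T `stub_polyNoChain`). -/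
def InPoly (d : ℕ) (A : Fin d → MvPowerSeries (Fin 2) k) : Prop :=
  WellPrepared d A ∧ IsPosT d A ∧ (newtonSet A).Nonempty

/-- THE DESCENT RELATION of Σ**_d inside the regime: `A′` is a strategy successor of `A`, both in the regime. -/
def PolyRel (d : ℕ) (A' A : Fin d → MvPowerSeries (Fin 2) k) : Prop :=
  A' ∈ succT d A ∧ InPoly d A ∧ InPoly d A'

/-- **ρ-T AS WELL-FOUNDEDNESS**: the descent relation is well-founded (no infinite Σ**_d-chain inside the regime: `stub_polyNoChain`, with ρ-P
`stub_polyPrep` and the minimality law `stub_polyMinimality` discharging its hypotheses — every field, every `d ≥ 1`). -/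
theorem wellFounded_polyRel {d : ℕ} (hd : 0 < d) : WellFounded (PolyRel (k := k) d) :=
  wellFounded_iff_isEmpty_descending_chain.mpr ⟨fun ⟨f, hf⟩ =>
    stub_polyNoChain k d hd (stub_polyPrep k d hd) (stub_polyMinimality k d hd)
      ⟨f, fun m => ⟨(hf m).2.1.1, (hf m).2.1.2.1, (hf m).2.1.2.2, (hf m).1⟩⟩⟩

/-- THE POLYHEDRON RANK of a label: its ordinal height in the descent relation. -/
noncomputable def polyRank {d : ℕ} (hd : 0 < d) (A : Fin d → MvPowerSeries (Fin 2) k) : Ordinal.{0} :=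
  ((wellFounded_polyRel (k := k) hd).apply A).rank

/-- A regime step lowers the polyhedron rank. -/
theorem polyRank_lt {d : ℕ} (hd : 0 < d) {A A' : Fin d → MvPowerSeries (Fin 2) k} (h : PolyRel d A' A) :
    polyRank hd A' < polyRank hd A :=
  ((wellFounded_polyRel (k := k) hd).apply A).rank_lt_of_rel h

/-! ## Leaving the regime -/

/-- **SUCCESSORS OF REGIME LABELS STAY WELL-PREPARED** (the transports `wellPrepared_divOneT/divTwoT/blowOneT/blowTwoT` + ρ-P): every
`A′ ∈ succT d A` of a well-prepared positive label is well-prepared. -/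
theorem wellPrepared_of_mem_succT {d : ℕ} (hd : 0 < d) {A A' : Fin d → MvPowerSeries (Fin 2) k} (hWP : WellPrepared d A)
    (hpos : IsPosT d A) (hA' : A' ∈ succT d A) : WellPrepared d A' := by
  classical
  have hprep := stub_polyPrep k d hd
  by_cases h1 : IsPermissibleOneT d A
  · rw [succT_of_isPermissibleOneT h1, Set.mem_singleton_iff] at hA'
    rw [hA']; exact wellPrepared_divOneT A h1 hWP
  by_cases h2 : IsPermissibleTwoT d A
  · rw [succT_of_isPermissibleTwoT h1 h2, Set.mem_singleton_iff] at hA'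
    rw [hA']; exact wellPrepared_divTwoT A h2 hWP
  by_cases h3 : HasGraphCurveT d A
  · rw [succT_of_hasGraphCurveT h1 h2 h3, Set.mem_singleton_iff] at hA'
    obtain ⟨ψ, -, -, hperm⟩ := graphShearT_spec h3
    have hposY : IsPosT d (shearT (graphShearT d A) A) := isPosT_shearT _ hpos
    obtain ⟨-, -, hWPB, -⟩ := isPrepRecentring_prepPsi (hprep _ hposY)
    have hpermB : IsPermissibleTwoT d (prep d (shearT (graphShearT d A) A)) := by
      refine isPermissibleTwoT_of_wellPrepared_of_isPermissibleTwoT_shift hd hWPB (φ := ψ - prepPsi d (shearT (graphShearT d A) A)) ?_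
      rw [prep, shift_shift, sub_add_cancel]
      exact hperm
    rw [hA']; exact wellPrepared_divTwoT _ hpermB hWPB
  · rw [succT_of_point h1 h2 h3] at hA'
    rcases hA' with hA' | ⟨c, -, rfl⟩
    · rcases hA' with rfl | rfl
      · exact wellPrepared_blowOneT A hpos hWP
      · exact wellPrepared_blowTwoT A hpos hWP
    · have hposY : IsPosT d (shearT (C c) A) := isPosT_shearT _ hpos
      obtain ⟨-, hposB, hWPB, -⟩ := isPrepRecentring_prepPsi (hprep _ hposY)
      exact wellPrepared_blowOneT _ hposB hWPB

/-- **THE REGIME EXITS, READ.**  If a successor label `A′ ∈ succT d A` of a regime label has left the regime, then EITHER its Newton set is empty (the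
zero label: germ `y^d`) OR it is not positive: some `ord A′_j ≤ d − j` — the order of the germ dropped below `d`, or the tangent cone is no longer
`y^d` (the directrix grew, `e ≤ 1`): the hand-over to the other regime pieces of the line. -/
theorem exit_cases {d : ℕ} (hd : 0 < d) {A A' : Fin d → MvPowerSeries (Fin 2) k} (hA : InPoly d A) (hA' : A' ∈ succT d A)
    (hn : ¬ InPoly d A') : ¬ (newtonSet A').Nonempty ∨ ¬ IsPosT d A' := by
  have hWP' := wellPrepared_of_mem_succT hd hA.1 hA.2.1 hA'
  by_contra h
  push Not at h
  exact hn ⟨hWP', h.2, h.1⟩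

end PolyDescent

end Summit.ResolutionOfSingularities.ResolutionOfSingularities.Theorems

end
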